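import Summits.BirchSwinnertonDyer.Rank1Residual.X2.HidaLimitRoadIntOther
import HarnessLib

/-!
# Crux 4 `BSDpOnCellC` (stmt-BirchSwinnertonDyer-19034), line b1 (v8.1 `99d6acbc` → v9), stub `stub_c3′`:
# LINKS for the re-oriented road-H / R-β / D′ halves of `X2/HidaLimitRoadIntOther.lean` (p489067) —
# consistency with the re-oriented atoms, derivation BY NAME from Keller–Yin Thm. D, and the v9
# `stub_c3` signature shape from the halves (cell `bsd-eis`, seat `bsd-eis-c3h` g4)

HONEST FRAMING (cell `bsd-eis`, run/shared/lean/pub/bsd-eis/): theorems only; nothing booked; X2 stays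
CONSTRUCTION-SHAPED; no label or count moves; BSD is not proved by any of this.

## What

`X2/HidaLimitRoadIntOther.lean` (p489067) re-typed the three residual halves of the IMC atom of line b1
in the faithful orientation (X-slot of `X_ac` at `𝔭̄`, frames at `(ι′, 𝔭)`; RULINGS L31 (2) / L33):
`X2.Nonsplit/SplitKolyvaginDivOnTreeIntOther` (road R-β), `X2.Nonsplit/SplitMuLambdaOnTreeIntOther`
(Keller–Yin D′) and `X2.HidaLimitRevDivOnTreeIntOther` (road H), with the glue "either divisibility
half + D′ ⟹ `X2.Nonsplit/SplitIMCEqOnTreeIntOther`" (the v9 atoms, p487050). This companion proves: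

* §1 consistency — each re-oriented atom implies its Kolyvagin half (`k = 0`) and both atoms imply
  road H's output (`a = 0`): the typed halves are INTERMEDIATE, never stronger than c3♭′ ∧ c3s♭′;
* §2 by name — Keller–Yin Thm. D (`KellerYin2024.thmD_…_OPEN`, PRE, taken as a hypothesis) gives both
  divisibility halves at every pair (through p487050's `…IMCEqOnTreeIntOther_of_thmD_OPEN`); the D′
  halves are NOT derivable from the typed Thm. D (it asserts the ideal equality, not `μ = 0`);
* §3 the v9 `stub_c3` signature (both conjuncts, VERBATIM as posted by cgshw g12 02:31:23Z:
  `(∀ W p, CellC → ¬split → NonsplitIMCEqOnTreeIntOther W p) ∧ (∀ W p, CellC → split →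
  SplitIMCEqOnTreeIntOther W p)`) from road H at `𝔭̄` + D′ at `𝔭̄` at each sign, class-wide, and from
  either divisibility half.

What this is NOT: not a proof of any half or of Thm. D; closes nothing by itself (helpers for the OWNER's
`BSDpOnCellC_of`).

References: [KellerYin2024] §3, §5.1, Thm. 5.1.3 = Thm. D (arXiv:2402.12781v2; PRE); cell rulings L31–L33.
-/

set_option autoImplicit false
set_option linter.dupNamespace false -- the summit namespace `…BirchSwinnertonDyer.BirchSwinnertonDyer.Theorems` (Sub = Summit, D-0017) trips it

noncomputable section

open scoped Classical MatrixGroups ModularForm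

open CongruenceSubgroup WeierstrassCurve NumberField IsDedekindDomain Field PowerSeries
  Literature.NumberTheory.EllipticCurves Literature.NumberTheory.EllipticCurves.GreenbergSelmer
  Literature.NumberTheory.EllipticCurves.ModularForms
  Literature.NumberTheory.EllipticCurves.Rank1Residual
  Literature.NumberTheory.EllipticCurves.Rank1Residual.Typed
  Literature.NumberTheory.GaloisRepresentations Literature.NumberTheory.GaloisCohomology
  Literature.NumberTheory.Automorphic
  Summit.BirchSwinnertonDyer.Rank1Residual.X11b.AcSelmer
  Summit.BirchSwinnertonDyer.Rank1Residual.X11b.Halves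
  Summit.BirchSwinnertonDyer.Rank1Residual.X11b
  Summit.BirchSwinnertonDyer.Rank1Residual.X2

namespace Summit.BirchSwinnertonDyer.BirchSwinnertonDyer.Theorems

/-! ### §1 Consistency: the re-oriented atom ⟹ each divisibility half (the halves are intermediate) -/

section ConsistencyOther

variable {W : WeierstrassCurve ℚ} [W.IsElliptic] [W.IsGloballyMinimal] {p : ℕ} [Fact p.Prime]

omit [W.IsElliptic] [W.IsGloballyMinimal] in
/-- **c3♭′ ⟹ c3♭′-div** (with `k = 0`): the Kolyvagin half is never stronger than the target. [folklore] -/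
theorem nonsplitKolyvaginDivOnTreeIntOther_of_imcEqOnTreeIntOther (h : NonsplitIMCEqOnTreeIntOther W p) :
    NonsplitKolyvaginDivOnTreeIntOther W p := by
  intro N _ K _ _ Dt H ιK P hc hns hN hK hd4 hHN hLt hP hcM hPinf hodd κ hκ γ _ 𝔭 h𝔭 he hf 𝔭bar h𝔭bar
    hne hsplit f hfW ι' hι' ΩK Ωp Q hΩK hΩp hQ
  have himc : R1.IMCEqIntAt W p κ 𝔭bar γ Q := h N K Dt H ιK P hc hns hN hK hd4 hHN hLt hP hcM hPinf
    hodd κ hκ γ 𝔭 h𝔭 he hf 𝔭bar h𝔭bar hne hsplit f hfW ι' hι' ΩK Ωp Q hΩK hΩp hQ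
  refine ⟨0, ?_⟩
  unfold R1.IMCEqIntAt at himc
  rw [himc, pow_zero, map_one, one_mul]
  exact Ideal.subset_span rfl

omit [W.IsElliptic] [W.IsGloballyMinimal] in
/-- **c3s♭′ ⟹ c3s♭′-div** (with `k = 0`). [folklore] -/
theorem splitKolyvaginDivOnTreeIntOther_of_imcEqOnTreeIntOther (h : SplitIMCEqOnTreeIntOther W p) :
    SplitKolyvaginDivOnTreeIntOther W p := by
  intro N _ K _ _ Dt H ιK P hc hs hN hK hd4 hHN hLt hP hcM hPinf hodd κ hκ γ _ 𝔭 h𝔭 he hf 𝔭bar h𝔭bar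
    hne hsplit f hfW ι' hι' ΩK Ωp Q hΩK hΩp hQ
  have himc : R1.IMCEqIntAt W p κ 𝔭bar γ Q := h N K Dt H ιK P hc hs hN hK hd4 hHN hLt hP hcM hPinf
    hodd κ hκ γ 𝔭 h𝔭 he hf 𝔭bar h𝔭bar hne hsplit f hfW ι' hι' ΩK Ωp Q hΩK hΩp hQ
  refine ⟨0, ?_⟩
  unfold R1.IMCEqIntAt at himc
  rw [himc, pow_zero, map_one, one_mul]
  exact Ideal.subset_span rfl

omit [W.IsElliptic] [W.IsGloballyMinimal] in
/-- **c3♭′ ∧ c3s♭′ ⟹ `HidaLimitRevDivOnTreeIntOther`** (with `a = 0`, splitting on the sign): road H's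
re-oriented output is INTERMEDIATE between the re-oriented IMC atoms and nothing. [folklore] -/
theorem hidaLimitRevDivOnTreeIntOther_of_imcEqOnTreeIntOther (hn : NonsplitIMCEqOnTreeIntOther W p)
    (hs : SplitIMCEqOnTreeIntOther W p) : HidaLimitRevDivOnTreeIntOther W p := by
  intro N _ K _ _ Dt H ιK P hc hN hK hd4 hHN hLt hP hcM hPinf hodd κ hκ γ _ 𝔭 h𝔭 he hf 𝔭bar h𝔭bar hne
    hsplit f hfW ι' hι' ΩK Ωp Q hΩK hΩp hQ F hchar
  have himc : R1.IMCEqIntAt W p κ 𝔭bar γ Q := by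
    by_cases hsW : W.HasSplitMultiplicativeReductionAtPrime p
    · exact hs N K Dt H ιK P hc hsW hN hK hd4 hHN hLt hP hcM hPinf hodd κ hκ γ 𝔭 h𝔭 he hf 𝔭bar h𝔭bar
        hne hsplit f hfW ι' hι' ΩK Ωp Q hΩK hΩp hQ
    · exact hn N K Dt H ιK P hc hsW hN hK hd4 hHN hLt hP hcM hPinf hodd κ hκ γ 𝔭 h𝔭 he hf 𝔭bar h𝔭bar
        hne hsplit f hfW ι' hι' ΩK Ωp Q hΩK hΩp hQ
  refine ⟨0, ?_⟩
  unfold R1.IMCEqIntAt at himc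
  rw [hchar, Ideal.map_span, Set.image_singleton] at himc
  rw [pow_zero, map_one, one_mul, ← himc]
  exact Ideal.subset_span rfl

end ConsistencyOther

/-! ### §2 By name from Keller–Yin Thm. D (PRE): both divisibility halves at every pair -/

section FromThmDOther

variable {W : WeierstrassCurve ℚ} [W.IsElliptic] [W.IsGloballyMinimal] {p : ℕ} [Fact p.Prime]

/-- **c3♭′-div from Keller–Yin Thm. D BY NAME** (through p487050's `nonsplitIMCEqOnTreeIntOther_of_thmD_OPEN`
and §1). CONDITIONAL on the OPEN fact (PRE, gapped at L1754); nothing asserted.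
[claim: KellerYin2024, status: under-review] [cite: KellerYin2024, Thm. D = Thm. 5.1.3 (arXiv:2402.12781v2 L306–L309)] -/
theorem nonsplitKolyvaginDivOnTreeIntOther_of_thmD_OPEN
    (hD : KellerYin2024.thmD_imcMult_exists_isBDPLFunction_isTorsion_charIdeal_eq_OPEN) :
    NonsplitKolyvaginDivOnTreeIntOther W p :=
  nonsplitKolyvaginDivOnTreeIntOther_of_imcEqOnTreeIntOther (nonsplitIMCEqOnTreeIntOther_of_thmD_OPEN hD)

/-- **c3s♭′-div from Keller–Yin Thm. D BY NAME.** CONDITIONAL on the OPEN fact; nothing asserted.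
[claim: KellerYin2024, status: under-review] [cite: KellerYin2024, Thm. D = Thm. 5.1.3 (arXiv:2402.12781v2 L306–L309), no sign hypothesis] -/
theorem splitKolyvaginDivOnTreeIntOther_of_thmD_OPEN
    (hD : KellerYin2024.thmD_imcMult_exists_isBDPLFunction_isTorsion_charIdeal_eq_OPEN) :
    SplitKolyvaginDivOnTreeIntOther W p :=
  splitKolyvaginDivOnTreeIntOther_of_imcEqOnTreeIntOther (splitIMCEqOnTreeIntOther_of_thmD_OPEN hD)

/-- **Road H's re-oriented output from Keller–Yin Thm. D BY NAME** (both signs). CONDITIONAL on the OPEN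
fact; nothing asserted. (The D′ halves are NOT derivable from the typed Thm. D, which asserts the
equality of ideals but not `μ = 0`.) [claim: KellerYin2024, status: under-review]
[cite: KellerYin2024, Thm. D = Thm. 5.1.3 (arXiv:2402.12781v2 L306–L309)] -/
theorem hidaLimitRevDivOnTreeIntOther_of_thmD_OPEN
    (hD : KellerYin2024.thmD_imcMult_exists_isBDPLFunction_isTorsion_charIdeal_eq_OPEN) :
    HidaLimitRevDivOnTreeIntOther W p :=
  hidaLimitRevDivOnTreeIntOther_of_imcEqOnTreeIntOther (nonsplitIMCEqOnTreeIntOther_of_thmD_OPEN hD)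
    (splitIMCEqOnTreeIntOther_of_thmD_OPEN hD)

end FromThmDOther

/-! ### §3 The v9 `stub_c3` signature shape from the re-oriented roads -/

section StubShapeOther

/-- **The v9 IMC stub of line b1 (both conjuncts, on the p487050 predicates) from road H at `𝔭̄` + D′ at
`𝔭̄` at each sign, class-wide.** CONDITIONAL on the typed hypotheses; nothing booked; no label or count
moves. [claim: KellerYin2024, status: under-review]
[cite: KellerYin2024, §5.1 and Thm. 5.1.3 = Thm. D (arXiv:2402.12781v2 L1725–L1770)] -/
theorem imcEqOnTreeIntOther_both_of_hidaLimitRevDivIntOther_of_muLambdaIntOther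
    (hrev : ∀ (W : WeierstrassCurve ℚ) [W.IsElliptic] [W.IsGloballyMinimal] (p : ℕ) [Fact p.Prime],
      CellC W p → HidaLimitRevDivOnTreeIntOther W p)
    (hml : ∀ (W : WeierstrassCurve ℚ) [W.IsElliptic] [W.IsGloballyMinimal] (p : ℕ) [Fact p.Prime],
      CellC W p → ¬ W.HasSplitMultiplicativeReductionAtPrime p → NonsplitMuLambdaOnTreeIntOther W p)
    (hmls : ∀ (W : WeierstrassCurve ℚ) [W.IsElliptic] [W.IsGloballyMinimal] (p : ℕ) [Fact p.Prime],
      CellC W p → W.HasSplitMultiplicativeReductionAtPrime p → SplitMuLambdaOnTreeIntOther W p) :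
    (∀ (W : WeierstrassCurve ℚ) [W.IsElliptic] [W.IsGloballyMinimal] (p : ℕ) [Fact p.Prime],
      CellC W p → ¬ W.HasSplitMultiplicativeReductionAtPrime p → NonsplitIMCEqOnTreeIntOther W p) ∧
    (∀ (W : WeierstrassCurve ℚ) [W.IsElliptic] [W.IsGloballyMinimal] (p : ℕ) [Fact p.Prime],
      CellC W p → W.HasSplitMultiplicativeReductionAtPrime p → SplitIMCEqOnTreeIntOther W p) :=
  ⟨fun W _ _ p _ hc hns ↦
      nonsplitIMCEqOnTreeIntOther_of_hidaLimitRevDivIntOther_of_muLambdaIntOther (hrev W p hc)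
        (hml W p hc hns),
    fun W _ _ p _ hc hs ↦
      splitIMCEqOnTreeIntOther_of_hidaLimitRevDivIntOther_of_muLambdaIntOther (hrev W p hc)
        (hmls W p hc hs)⟩

/-- **The v9 IMC stub of line b1 from EITHER divisibility half (R-β at the sign, or road H) + D′ at
`𝔭̄`, class-wide.** CONDITIONAL; nothing booked. [claim: KellerYin2024, status: under-review]
[cite: KellerYin2024, §3, §5.1 and Thm. 5.1.3 = Thm. D (arXiv:2402.12781v2)] -/
theorem imcEqOnTreeIntOther_both_of_divIntOther_or_hidaLimitRevDivIntOther_of_muLambdaIntOther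
    (hdiv : ∀ (W : WeierstrassCurve ℚ) [W.IsElliptic] [W.IsGloballyMinimal] (p : ℕ) [Fact p.Prime],
      CellC W p → (NonsplitKolyvaginDivOnTreeIntOther W p ∧ SplitKolyvaginDivOnTreeIntOther W p) ∨
        HidaLimitRevDivOnTreeIntOther W p)
    (hml : ∀ (W : WeierstrassCurve ℚ) [W.IsElliptic] [W.IsGloballyMinimal] (p : ℕ) [Fact p.Prime],
      CellC W p → ¬ W.HasSplitMultiplicativeReductionAtPrime p → NonsplitMuLambdaOnTreeIntOther W p)
    (hmls : ∀ (W : WeierstrassCurve ℚ) [W.IsElliptic] [W.IsGloballyMinimal] (p : ℕ) [Fact p.Prime],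
      CellC W p → W.HasSplitMultiplicativeReductionAtPrime p → SplitMuLambdaOnTreeIntOther W p) :
    (∀ (W : WeierstrassCurve ℚ) [W.IsElliptic] [W.IsGloballyMinimal] (p : ℕ) [Fact p.Prime],
      CellC W p → ¬ W.HasSplitMultiplicativeReductionAtPrime p → NonsplitIMCEqOnTreeIntOther W p) ∧
    (∀ (W : WeierstrassCurve ℚ) [W.IsElliptic] [W.IsGloballyMinimal] (p : ℕ) [Fact p.Prime],
      CellC W p → W.HasSplitMultiplicativeReductionAtPrime p → SplitIMCEqOnTreeIntOther W p) := by
  refine ⟨fun W _ _ p _ hc hns ↦ ?_, fun W _ _ p _ hc hs ↦ ?_⟩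
  · rcases hdiv W p hc with ⟨hd, -⟩ | hrev
    · exact nonsplitIMCEqOnTreeIntOther_of_divIntOther_of_muLambdaIntOther hd (hml W p hc hns)
    · exact nonsplitIMCEqOnTreeIntOther_of_hidaLimitRevDivIntOther_of_muLambdaIntOther hrev
        (hml W p hc hns)
  · rcases hdiv W p hc with ⟨-, hd⟩ | hrev
    · exact splitIMCEqOnTreeIntOther_of_divIntOther_of_muLambdaIntOther hd (hmls W p hc hs)
    · exact splitIMCEqOnTreeIntOther_of_hidaLimitRevDivIntOther_of_muLambdaIntOther hrev
        (hmls W p hc hs)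

end StubShapeOther

end Summit.BirchSwinnertonDyer.BirchSwinnertonDyer.Theorems

end
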